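import Literature.NumberTheory.LFunctions.ClassGroupExplicitFormula
import Literature.NumberTheory.LFunctions.UniformClassGroupPNTCharacterSums
import HarnessLib

/-!
# Smoothed von Mangoldt sums over an ideal class and their character expansion

Topic `Literature/NumberTheory/LFunctions`, namespace `Literature.NumberTheory.LFunctions.NumberField`.
Everything here is PROVED; `vonMangoldtClass`, `smoothedPsiClass` are definitions with bodies.

* `vonMangoldtClass K C n = Λ_C(n) = Σ_{N𝔫 = n, [𝔫] = C} Λ(𝔫)` (`0 ≤ Λ_C(n)`, `Σ_C Λ_C(n) = Λ_K(n) ≤ n_K Λ(n)`);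
* `smoothedPsiClass K C g = ψ̃_C(g) = Σ_n Λ_C(n) g(log n)` (Thorner–Zaman's `ψ̃_C(x; f)`, [ThornerZaman2019, (2.13)]);
* orthogonality: `Σ_ψ ψ(C⁻¹) Λ_{χ_ψ}(n) = h · Λ_C(n)` (`sum_apply_inv_mul_cgCoef`) and
  **`h · ψ̃_C(g) = Σ_ψ ψ(C⁻¹) K_{g, Λ_{χ_ψ}}(0)`** (`classNumber_mul_smoothedPsiClass`), where
  `K_{g,a}(0) = Σ_n a(n) g(log n)` is the tree's `coefFordK a g 0` — the passage (4.2) of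
  [ThornerZaman2019] from class sums to character sums, for the smoothed prime-power sums.

## References

* J. Thorner, A. Zaman, ANT 13 (2019), §2.4 (2.13) and §4.2 (4.2). [ThornerZaman2019]
-/

noncomputable section

open Complex Finset
open scoped NumberField nonZeroDivisors

namespace Literature.NumberTheory.LFunctions.NumberField

open Literature.NumberTheory.LFunctions.AbelianDensity

variable {K : Type} [Field K] [NumberField K]

/-! ### `Λ_C(n)` -/

open scoped Classical in
variable (K) in
/-- The class indicator on ideals: `𝟙_C(𝔫) = 1` if `𝔫 ≠ 0` and `[𝔫] = C`, else `0`. [folklore] -/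
def classIndicatorIdeal (C : ClassGroup (𝓞 K)) (I : Ideal (𝓞 K)) : ℝ :=
  if h : I = ⊥ then 0 else if ClassGroup.mk0 ⟨I, mem_nonZeroDivisors_of_ne_zero h⟩ = C then 1 else 0

variable (K) in
/-- **`Λ_C(n) = Σ_{N𝔫 = n, [𝔫] = C} Λ(𝔫)`**, the von Mangoldt function of the ideal class `C`
collected by norm. [cite: ThornerZaman2019, §2.4 (2.13)] -/
def vonMangoldtClass (C : ClassGroup (𝓞 K)) (n : ℕ) : ℝ :=
  ∑ I ∈ idealsOfNorm K n, classIndicatorIdeal K C I * idealVonMangoldt I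

/-- `0 ≤ 𝟙_C ≤ 1`. [folklore] -/
theorem classIndicatorIdeal_mem (C : ClassGroup (𝓞 K)) (I : Ideal (𝓞 K)) :
    0 ≤ classIndicatorIdeal K C I ∧ classIndicatorIdeal K C I ≤ 1 := by
  unfold classIndicatorIdeal
  split_ifs <;> norm_num

/-- `Λ_C(n) ≥ 0`. [folklore] -/
theorem vonMangoldtClass_nonneg (C : ClassGroup (𝓞 K)) (n : ℕ) : 0 ≤ vonMangoldtClass K C n :=
  sum_nonneg fun I _ ↦ mul_nonneg (classIndicatorIdeal_mem C I).1 (idealVonMangoldt_nonneg I)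

/-- `Σ_C 𝟙_C(𝔫) = 1` for `𝔫 ≠ 0`. [folklore] -/
theorem sum_classIndicatorIdeal {I : Ideal (𝓞 K)} (hI : I ≠ ⊥) : ∑ C, classIndicatorIdeal K C I = 1 := by
  classical
  unfold classIndicatorIdeal
  simp only [dif_neg hI]
  rw [Finset.sum_ite_eq, if_pos (mem_univ _)]

/-- **`Σ_C Λ_C(n) = Λ_K(n)`** (`= vonMangoldtNorm K n = Σ_{N𝔫 = n} Λ(𝔫)`), for `n ≠ 0`. [folklore] -/
theorem sum_vonMangoldtClass {n : ℕ} (hn : n ≠ 0) : ∑ C, vonMangoldtClass K C n = vonMangoldtNorm K n := by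
  classical
  unfold vonMangoldtClass
  rw [sum_comm, vonMangoldtNorm]
  refine sum_congr rfl fun I hI ↦ ?_
  rw [mem_idealsOfNorm] at hI
  have hI0 : I ≠ ⊥ := by
    rintro rfl; rw [Ideal.absNorm_bot] at hI; exact hn hI.symm
  rw [← sum_mul, sum_classIndicatorIdeal hI0, one_mul]

/-- `Λ_C(n) ≤ Λ_K(n) ≤ n_K Λ(n)`. [folklore] -/
theorem vonMangoldtClass_le (C : ClassGroup (𝓞 K)) (n : ℕ) :
    vonMangoldtClass K C n ≤ vonMangoldtNorm K n ∧ vonMangoldtClass K C n ≤ Module.finrank ℚ K * ArithmeticFunction.vonMangoldt n := by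
  have h1 : vonMangoldtClass K C n ≤ vonMangoldtNorm K n := by
    unfold vonMangoldtClass vonMangoldtNorm
    exact sum_le_sum fun I _ ↦ by
      have := (classIndicatorIdeal_mem C I).2
      have h0 := idealVonMangoldt_nonneg I
      nlinarith
  exact ⟨h1, h1.trans (vonMangoldtNorm_le_finrank_mul n)⟩

/-- `Λ_C(0) = 0` (only `⊥` has norm `0`, and `𝟙_C(⊥) = 0`). [folklore] -/
theorem vonMangoldtClass_zero (C : ClassGroup (𝓞 K)) : vonMangoldtClass K C 0 = 0 := by
  unfold vonMangoldtClass
  refine sum_eq_zero fun I hI ↦ ?_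
  rw [mem_idealsOfNorm, Ideal.absNorm_eq_zero_iff] at hI
  simp [classIndicatorIdeal, hI]

/-! ### Orthogonality for `Λ_χ(n)` -/

/-- Pointwise: `χ([𝔫]) Λ(𝔫) = Σ_C χ(C) 𝟙_C(𝔫) Λ(𝔫)`. [folklore] -/
theorem classGroupCharIdealHom_mul_eq_sum (χ : ClassGroup (𝓞 K) →* ℂˣ) (I : Ideal (𝓞 K)) :
    classGroupCharIdealHom χ I * (idealVonMangoldt I : ℂ) =
      ∑ C, (χ C : ℂ) * ((classIndicatorIdeal K C I : ℝ) * idealVonMangoldt I : ℝ) := by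
  classical
  by_cases hI0 : I = ⊥
  · subst hI0
    simp [classIndicatorIdeal, idealVonMangoldt_bot]
  · rw [classGroupCharIdealHom_apply_of_ne_bot χ hI0]
    unfold classIndicatorIdeal
    simp only [dif_neg hI0]
    rw [Finset.sum_eq_single (ClassGroup.mk0 ⟨I, mem_nonZeroDivisors_of_ne_zero hI0⟩)]
    · simp
    · intro C _ hC
      rw [if_neg (Ne.symm hC)]; simp
    · intro h; exact absurd (mem_univ _) h

/-- `Λ_χ(n) = Σ_{N𝔫 = n} χ([𝔫]) Λ(𝔫) = Σ_C χ(C) Λ_C(n)`. [folklore] -/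
theorem cgCoef_eq_sum_vonMangoldtClass (χ : ClassGroup (𝓞 K) →* ℂˣ) (n : ℕ) :
    cgCoef χ n = ∑ C, (χ C : ℂ) * (vonMangoldtClass K C n : ℂ) := by
  classical
  rw [cgCoef, twistVonMangoldt]
  unfold vonMangoldtClass
  simp_rw [ofReal_sum, mul_sum]
  rw [sum_comm]
  exact sum_congr rfl fun I _ ↦ classGroupCharIdealHom_mul_eq_sum χ I

/-- **Orthogonality**: `Σ_ψ ψ(C⁻¹) Λ_{χ_ψ}(n) = h · Λ_C(n)`. [cite: ThornerZaman2019, §4.2 (4.2)] -/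
theorem sum_apply_inv_mul_cgCoef (C : ClassGroup (𝓞 K)) (n : ℕ) :
    ∑ ψ : AddChar (Additive (ClassGroup (𝓞 K))) ℂ,
        ψ (Additive.ofMul C⁻¹) * cgCoef (toMulHom ψ).toHomUnits n =
      (Fintype.card (ClassGroup (𝓞 K)) : ℂ) * (vonMangoldtClass K C n : ℂ) := by
  classical
  simp_rw [cgCoef_eq_sum_vonMangoldtClass, toHomUnits_toMulHom_apply, mul_sum]
  rw [sum_comm]
  have key : ∀ C' : ClassGroup (𝓞 K),
      ∑ ψ : AddChar (Additive (ClassGroup (𝓞 K))) ℂ, ψ (Additive.ofMul C⁻¹) *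
          (ψ (Additive.ofMul C') * (vonMangoldtClass K C' n : ℂ)) =
        (if C = C' then (Fintype.card (ClassGroup (𝓞 K)) : ℂ) else 0) * (vonMangoldtClass K C' n : ℂ) := by
    intro C'
    simp_rw [← mul_assoc, ← AddChar.map_add_eq_mul]
    rw [← sum_mul, ← ofMul_mul, sum_classGroupChar_apply_eq_ite]
    by_cases hC : C = C'
    · rw [if_pos hC, if_pos (inv_mul_eq_one.2 hC)]
    · rw [if_neg hC, if_neg (mt inv_mul_eq_one.1 hC)]
  simp_rw [key, ite_mul, zero_mul]
  rw [sum_ite_eq univ C, if_pos (mem_univ C)]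

/-! ### The smoothed class sum `ψ̃_C` -/

variable (K) in
/-- **`ψ̃_C(g) = Σ_n Λ_C(n) g(log n)`** (Thorner–Zaman's `ψ̃_C(x; f)` with `g = f(·/log x)`-type
weights; a finite sum when `g` has compact support). [cite: ThornerZaman2019, §2.4 (2.13)] -/
def smoothedPsiClass (C : ClassGroup (𝓞 K)) (g : ℝ → ℝ) : ℝ :=
  ∑' n : ℕ, vonMangoldtClass K C n * g (Real.log n)

/-- `ψ̃_C(g)` as a finite sum when `g = 0` on `[x₀, ∞)` and `x₀ ≤ log N`. [folklore] -/
theorem smoothedPsiClass_eq_sum (C : ClassGroup (𝓞 K)) {g : ℝ → ℝ} {x₀ : ℝ} (hg : ∀ u, x₀ ≤ u → g u = 0)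
    {N : ℕ} (hN : 1 ≤ N) (hx : x₀ ≤ Real.log N) :
    smoothedPsiClass K C g = ∑ n ∈ Finset.range N, vonMangoldtClass K C n * g (Real.log n) := by
  rw [smoothedPsiClass, tsum_eq_sum]
  intro n hn
  rw [Finset.mem_range, not_lt] at hn
  have hlog : x₀ ≤ Real.log n := hx.trans (Real.log_le_log (by exact_mod_cast hN) (by exact_mod_cast hn))
  simp [hg _ hlog]

/-- **`h · ψ̃_C(g) = Σ_ψ ψ(C⁻¹) K_{g, Λ_{χ_ψ}}(0)`**: the smoothed class sum through the character sums
`K_{g,Λ_χ}(0) = Σ_n Λ_χ(n) g(log n)` (`coefFordK (cgCoef χ) g 0`), for `g` vanishing on `[x₀, ∞)`.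
[cite: ThornerZaman2019, §4.2 (4.2)] -/
theorem classNumber_mul_smoothedPsiClass (C : ClassGroup (𝓞 K)) {g : ℝ → ℝ} {x₀ : ℝ} (hg : ∀ u, x₀ ≤ u → g u = 0) :
    (NumberField.classNumber K : ℂ) * (smoothedPsiClass K C g : ℂ) =
      ∑ ψ : AddChar (Additive (ClassGroup (𝓞 K))) ℂ,
        ψ (Additive.ofMul C⁻¹) * coefFordK (cgCoef (toMulHom ψ).toHomUnits) g 0 := by
  classical
  -- a common truncation
  obtain ⟨N, hN⟩ : ∃ N : ℕ, x₀ ≤ Real.log N ∧ 1 ≤ N := by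
    obtain ⟨N, hN⟩ := exists_nat_gt (Real.exp x₀)
    refine ⟨N, ?_, ?_⟩
    · have hN0 : (0 : ℝ) < N := (Real.exp_pos _).trans hN
      rw [Real.le_log_iff_exp_le hN0]; exact hN.le
    · have : (0 : ℝ) < N := (Real.exp_pos _).trans hN
      exact_mod_cast Nat.one_le_iff_ne_zero.2 (by rintro rfl; simp at this)
  rw [smoothedPsiClass_eq_sum C hg hN.2 hN.1]
  simp_rw [coefFordK_eq_sum _ hg hN.2 hN.1, neg_zero, Complex.cpow_zero, mul_one, mul_sum]
  rw [sum_comm, ofReal_sum, mul_sum]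
  refine sum_congr rfl fun n _ ↦ ?_
  simp_rw [← mul_assoc]
  rw [← sum_mul, sum_apply_inv_mul_cgCoef, ofReal_mul]
  rw [show (Fintype.card (ClassGroup (𝓞 K)) : ℂ) = (NumberField.classNumber K : ℂ) from rfl]
  ring

/-- `0 ≤ ψ̃_C(g)` for `g ≥ 0`. [folklore] -/
theorem smoothedPsiClass_nonneg (C : ClassGroup (𝓞 K)) {g : ℝ → ℝ} (hg : ∀ u, 0 ≤ g u) : 0 ≤ smoothedPsiClass K C g :=
  tsum_nonneg fun n ↦ mul_nonneg (vonMangoldtClass_nonneg C n) (hg _)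


end Literature.NumberTheory.LFunctions.NumberField

end
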